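import Literature.Computability.AlgebraicComplexity.BorderRankMatMulTwoCert
import HarnessLib

/-!
# The `⟨2,2,3⟩` border apolarity test, torus-fixed candidates (I): slots, weight vectors, checker

Topic `Literature/Computability/AlgebraicComplexity`.  Support file for the KERNEL proof of the lower
bound of Conner–Harper–Landsberg 2023, Thm. 1.3 (`R̲(M_⟨223⟩) = 10`; discharge of the named fact
`ConnerHarperLandsberg2023_thm_1_3` of `BorderRankMatMulSmall.lean`, whose upper half `≤ 10` is the
tree's `BCRL1979_algBorderRank_matMulTensor_223_le`) by the elementary TORUS-fixed border apolarity
route of the tree's `R̲(⟨2,2,2⟩) = 7` proof (`BorderRankMatMulTwoCert.lean`,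
`BorderRankMatMulTwoWeights.lean`, `BorderRankMatMulTwoApolarity.lean`), transplanted to the format
`A* = K^{2×2}` (coordinates `(i,j)`), `B* = K^{2×3}` (coordinates `(j',k)`) of
`matMulTensor K 2 2 3 : (Fin 2 × Fin 3) → (Fin 2 × Fin 2) → (Fin 2 × Fin 3) → K`:

* `MatMul223.A2 = Fin 2 × Fin 2`, `MatMul223.B23 = Fin 2 × Fin 3`, the gradings `degA (i,j) = 9i − 3j`,
  `degB (j',k) = 3j' + k`, `deg2`, `deg3A`, `deg3B` (a one-parameter subgroup of the torus of
  `GL(U) × GL(V) × GL(W)`, additive under the multiplication maps and separating the `18` weight lines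
  of `M_⟨223⟩(C*)^⊥ ⊂ A* ⊗ B*`), the `18` weight vectors `wvZ k` (`12` monomials `X_{ij} ⊗ Y_{j'k}`,
  `j ≠ j'`, `6` binomials `X_{i0} ⊗ Y_{0k} − X_{i1} ⊗ Y_{1k}`; CHL 2023 §4: `M(C*)^⊥ = U* ⊗ 𝔰𝔩(V) ⊗ W`)
  with degrees `wdeg`, and the test products `rowFunA k a = ω_k · e_a ∈ S²A* ⊗ B*`,
  `rowFunB k b = ω_k · e_b ∈ A* ⊗ S²B*` (the `(210)`/`(120)` maps of CHL §3, through the tree's generic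
  `MatMulTwo.mul210Fun` / `MatMulTwo.mul120Fun`, ordered coordinates).
* `CertEntry`, `CertEntry.ok`, `checkChunk` — the certificate format (omitted weight lines
  `p < q < s`, a test, `52` resp. `76` products with pivot coordinates, upper triangular with nonzero
  diagonal) and its Boolean checker; the data (`816 = C(18,3)` entries) and the kernel runs are in
  `BorderRankMatMul223CertData1…5.lean`, the soundness theorem in `BorderRankMatMul223CertSound.lean`.

## References

* A. Conner, A. Harper, J. M. Landsberg, *New lower bounds for matrix multiplication and `det₃`*,
  Forum Math. Pi 11 (2023) e17 = arXiv:1911.07981, Thm. 1.3, §3 (tests), §4 (`M(C*)^⊥`), §7.2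
  (`M_⟨223⟩`: "eight 𝔹-fixed 3-planes … (210)-test … (120)-test"). [ConnerHarperLandsberg2023]

## Design choices

As in the `2 × 2` file: no `native_decide`, no extra axioms; ordered coordinates for the symmetric
powers; only dimensions of spans are compared.
-/

namespace Literature.Computability.AlgebraicComplexity

namespace MatMul223

/-! ## Slots, gradings, weight vectors, test products -/

/-- `A*`-coordinates of `⟨2,2,3⟩`: index pairs `(i, j)`, `i, j < 2`. [folklore] -/
abbrev A2 : Type := Fin 2 × Fin 2

/-- `B*`-coordinates of `⟨2,2,3⟩`: index pairs `(j', k)`, `j' < 2`, `k < 3`. [folklore] -/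
abbrev B23 : Type := Fin 2 × Fin 3

/-- Degree of the `A*`-coordinate `(i, j)`: `9i − 3j`. [cite: ConnerHarperLandsberg2023, §2.5] -/
def degA (a : A2) : ℤ := 9 * (a.1 : ℕ) - 3 * (a.2 : ℕ)

/-- Degree of the `B*`-coordinate `(j', k)`: `3j' + k`. [cite: ConnerHarperLandsberg2023, §2.5] -/
def degB (b : B23) : ℤ := 3 * (b.1 : ℕ) + (b.2 : ℕ)

/-- Degree on `A* ⊗ B*`. [cite: ConnerHarperLandsberg2023, §2.5] -/
def deg2 (s : A2 × B23) : ℤ := degA s.1 + degB s.2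

/-- Degree on `A* ⊗ A* ⊗ B*` (home of the `(210)` products). [cite: ConnerHarperLandsberg2023, §2.5] -/
def deg3A (t : A2 × A2 × B23) : ℤ := degA t.1 + degA t.2.1 + degB t.2.2

/-- Degree on `A* ⊗ B* ⊗ B*` (home of the `(120)` products). [cite: ConnerHarperLandsberg2023, §2.5] -/
def deg3B (t : A2 × B23 × B23) : ℤ := degA t.1 + degB t.2.1 + degB t.2.2

/-- Encoding of an `A*`-coordinate as `0..3`. [folklore] -/
def encA (a : A2) : ℕ := 2 * (a.1 : ℕ) + (a.2 : ℕ)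

/-- Encoding of a `B*`-coordinate as `0..5`. [folklore] -/
def encB (b : B23) : ℕ := 3 * (b.1 : ℕ) + (b.2 : ℕ)

/-- Encoding of an `A* ⊗ B*` coordinate as `0..23`. [folklore] -/
def encS (s : A2 × B23) : ℕ := 6 * encA s.1 + encB s.2

/-- Decoding `0..3` to an `A*`-coordinate. [folklore] -/
def decA (n : ℕ) : A2 := (⟨n / 2 % 2, Nat.mod_lt _ two_pos⟩, ⟨n % 2, Nat.mod_lt _ two_pos⟩)

/-- Decoding `0..5` to a `B*`-coordinate. [folklore] -/
def decB (n : ℕ) : B23 := (⟨n / 3 % 2, Nat.mod_lt _ two_pos⟩, ⟨n % 3, Nat.mod_lt _ (by decide)⟩)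

/-- Decoding `0..95` to a coordinate of `K^{A2 × A2 × B23}` (`24x + 6y + z`). [folklore] -/
def decTA (c : ℕ) : A2 × A2 × B23 := (decA (c / 24), decA (c / 6 % 4), decB (c % 6))

/-- Decoding `0..143` to a coordinate of `K^{A2 × B23 × B23}` (`36x + 6y + z`). [folklore] -/
def decTB (c : ℕ) : A2 × B23 × B23 := (decA (c / 36), decB (c / 6 % 6), decB (c % 6))

/-- Decoding `0..17` to a weight-line index. [folklore] -/
def decK (k : ℕ) : Fin 18 := ⟨k % 18, Nat.mod_lt _ (by decide)⟩

/-- The `18` torus weight vectors of `M_⟨223⟩(C*)^⊥ ⊂ A* ⊗ B*` (integer coordinates): for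
`k < 12` the monomials `X_{ij} ⊗ Y_{j'k}` with `j ≠ j'`, for `k ≥ 12` the binomials
`X_{i0} ⊗ Y_{0k} − X_{i1} ⊗ Y_{1k}` (CHL 2023 §4: `U* ⊗ 𝔰𝔩(V) ⊗ W`).
[cite: ConnerHarperLandsberg2023, §4 (M(C*)^⊥ = U* ⊗ sl(V) ⊗ W)] -/
def wvZ (k : Fin 18) (s : A2 × B23) : ℤ :=
  match k.val with
  | 0 => if encS s = 3 then 1 else 0
  | 1 => if encS s = 4 then 1 else 0
  | 2 => if encS s = 5 then 1 else 0
  | 3 => if encS s = 6 then 1 else 0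
  | 4 => if encS s = 7 then 1 else 0
  | 5 => if encS s = 8 then 1 else 0
  | 6 => if encS s = 15 then 1 else 0
  | 7 => if encS s = 16 then 1 else 0
  | 8 => if encS s = 17 then 1 else 0
  | 9 => if encS s = 18 then 1 else 0
  | 10 => if encS s = 19 then 1 else 0
  | 11 => if encS s = 20 then 1 else 0
  | 12 => if encS s = 0 then 1 else if encS s = 9 then -1 else 0
  | 13 => if encS s = 1 then 1 else if encS s = 10 then -1 else 0
  | 14 => if encS s = 2 then 1 else if encS s = 11 then -1 else 0
  | 15 => if encS s = 12 then 1 else if encS s = 21 then -1 else 0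
  | 16 => if encS s = 13 then 1 else if encS s = 22 then -1 else 0
  | _ => if encS s = 14 then 1 else if encS s = 23 then -1 else 0

/-- The degrees of the `18` weight vectors (pairwise distinct: a permutation of `-3..14`).
[cite: ConnerHarperLandsberg2023, §2.5] -/
def wdeg (k : Fin 18) : ℤ :=
  match k.val with
  | 0 => 3 | 1 => 4 | 2 => 5 | 3 => -3 | 4 => -2 | 5 => -1 | 6 => 12 | 7 => 13 | 8 => 14 | 9 => 6 | 10 => 7 | 11 => 8 | 12 => 0 | 13 => 1 | 14 => 2 | 15 => 9 | 16 => 10 | _ => 11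


section Mul

variable (R : Type*) [CommRing R]

/-- The weight vectors with coefficients in `R`. [cite: ConnerHarperLandsberg2023, §4] -/
def wv (k : Fin 18) (s : A2 × B23) : R := (wvZ k s : R)

/-- The `(210)` test product `ω_k · e_a ∈ S²A* ⊗ B*` (ordered coordinates `A* ⊗ A* ⊗ B*`).
[cite: ConnerHarperLandsberg2023, §3 (the (210)-map)] -/
def rowFunA (k : Fin 18) (a : A2) (t : A2 × A2 × B23) : R := MatMulTwo.mul210Fun R a (wv R k) t

/-- The `(120)` test product `ω_k · e_b ∈ A* ⊗ S²B*` (ordered coordinates `A* ⊗ B* ⊗ B*`).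
[cite: ConnerHarperLandsberg2023, §3 (the (120)-map)] -/
def rowFunB (k : Fin 18) (b : B23) (t : A2 × B23 × B23) : R := MatMulTwo.mul120Fun R b (wv R k) t

/-- The set of `(210)` test products `{ω_k · e_a : k ∈ S, a}`. [cite: ConnerHarperLandsberg2023, §3] -/
def genSetA (S : Finset (Fin 18)) : Set (A2 × A2 × B23 → R) :=
  {x | ∃ k ∈ S, ∃ a : A2, x = rowFunA R k a}

/-- The set of `(120)` test products `{ω_k · e_b : k ∈ S, b}`. [cite: ConnerHarperLandsberg2023, §3] -/
def genSetB (S : Finset (Fin 18)) : Set (A2 × B23 × B23 → R) :=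
  {x | ∃ k ∈ S, ∃ b : B23, x = rowFunB R k b}

/-- The `(210)` products over `R` are the images of the integer ones.
[cite: ConnerHarperLandsberg2023, §3 (the (210)-map; integer structure constants)] -/
theorem rowFunA_eq_cast (k : Fin 18) (a : A2) (t : A2 × A2 × B23) :
    rowFunA R k a t = ((rowFunA ℤ k a t : ℤ) : R) := by
  simp [rowFunA, MatMulTwo.mul210Fun, wv, Int.cast_ite]

/-- The `(120)` products over `R` are the images of the integer ones.
[cite: ConnerHarperLandsberg2023, §3 (the (120)-map; integer structure constants)] -/
theorem rowFunB_eq_cast (k : Fin 18) (b : B23) (t : A2 × B23 × B23) :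
    rowFunB R k b t = ((rowFunB ℤ k b t : ℤ) : R) := by
  simp [rowFunB, MatMulTwo.mul120Fun, wv, Int.cast_ite]

end Mul

/-! ## The certificate format and the checker -/

/-- One certificate: omitted weight lines `p < q < s`, the failing test (`false` = `(210)` with `52`
rows, `true` = `(120)` with `76` rows), and the rows `(k, c, pivot)` = the product `ω_k · e_{dec c}`
and a pivot coordinate (certificate format for the tests of CHL 2023, §7.2).
[cite: ConnerHarperLandsberg2023, §7.2 (the (210)- and (120)-tests for M_⟨223⟩)] -/
structure CertEntry where
  /-- first omitted weight line -/
  p : ℕ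
  /-- second omitted weight line -/
  q : ℕ
  /-- third omitted weight line -/
  s : ℕ
  /-- the test: `false` = `(210)`, `true` = `(120)` -/
  test : Bool
  /-- the rows `(k, coordinate, pivot)` -/
  rows : List (ℕ × ℕ × ℕ)

/-- The number of rows a test needs: `52 = 60 − 9 + 1` resp. `76 = 84 − 9 + 1`. [folklore] -/
def CertEntry.n (e : CertEntry) : ℕ := if e.test then 76 else 52

/-- Row `i` of an entry (junk `(0,0,0)` out of range). [folklore] -/
def CertEntry.row (e : CertEntry) (i : ℕ) : ℕ × ℕ × ℕ := e.rows.getD i (0, 0, 0)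

/-- `(210)` value of row `i` at the pivot of row `j`. [folklore] -/
def CertEntry.valA (e : CertEntry) (i j : ℕ) : ℤ :=
  rowFunA ℤ (decK (e.row i).1) (decA (e.row i).2.1) (decTA (e.row j).2.2)

/-- `(120)` value of row `i` at the pivot of row `j`. [folklore] -/
def CertEntry.valB (e : CertEntry) (i j : ℕ) : ℤ :=
  rowFunB ℤ (decK (e.row i).1) (decB (e.row i).2.1) (decTB (e.row j).2.2)

/-- The value of row `i` at the pivot of row `j` for the entry's test. [folklore] -/
def CertEntry.val (e : CertEntry) (i j : ℕ) : ℤ := if e.test then e.valB i j else e.valA i j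

/-- An entry is valid: `p < q < s < 18`, `n` rows using allowed weight lines, upper triangular pivot
values with nonzero diagonal. [folklore] -/
def CertEntry.ok (e : CertEntry) : Bool :=
  decide (e.p < e.q ∧ e.q < e.s ∧ e.s < 18) && (e.rows.length == e.n) &&
    (List.range e.n).all fun i =>
      decide ((e.row i).1 < 18 ∧ (e.row i).1 ≠ e.p ∧ (e.row i).1 ≠ e.q ∧ (e.row i).1 ≠ e.s) &&
        decide (e.val i i ≠ 0) &&
          (List.range e.n).all fun j => decide (j < i → e.val i j = 0)

/-- A chunk of certificates is valid. [folklore] -/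
def checkChunk (l : List CertEntry) : Bool := l.all CertEntry.ok

/-- Validity of a concatenation of certificate chunks.
[cite: ConnerHarperLandsberg2023, §7.2 (the (210)- and (120)-tests for M_⟨223⟩)] -/
theorem checkChunk_append {l₁ l₂ : List CertEntry} (h₁ : checkChunk l₁ = true)
    (h₂ : checkChunk l₂ = true) : checkChunk (l₁ ++ l₂) = true := by
  unfold checkChunk at *
  rw [List.all_append, h₁, h₂, Bool.and_self]

end MatMul223

end Literature.Computability.AlgebraicComplexity
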